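import Literature.Geometry.Riemannian.SchurLemma
import Literature.Geometry.Riemannian.RicciLowerBoundTrace
import HarnessLib

/-!
# `threeShrinkerClassification_modelData` for compact members with `Ric ≥ (R/3) h`

The first of the two cases of the compact classification (Eminenti–La Nave–Mantegazza 2008, §3,
p. 7: at the minimum point of `λ_min(Ric)/R` either all eigenvalues of `Ric` coincide — "then
`λ_min(p) = R/n` and since we are in the point of minimum, `R_{ij} ≥ R g_{ij}/n` on the whole
manifold. But this inequality easily implies that `(M, g)` is an Einstein manifold" — or
`λ_min(p) = 0`), closed over the tree's vocabulary: for a compact member of the binder of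
`Literature.Geometry.Riemannian.threeShrinkerClassification_modelData` with
`Ric_x(w,w) ≥ (R(x)/3)|w|²` everywhere, `Ric = (R/3) h` pointwise
(`ricci_eq_smul_of_forall_le`, `RicciLowerBoundTrace.lean`), hence `h` is Einstein by Schur's lemma
and the conclusion of the fact holds (`ThreeShrinker.modelData_of_ricci_eq_fun_smul`,
`SchurLemma.lean`). Everything is proved; no definitions are introduced.

## References

* M. Eminenti, G. La Nave, C. Mantegazza, manuscripta math. 127 (2008), §3 (p. 7). [EminentiLanaveMantegazza2008]
* O. Munteanu, J. Wang, arXiv:1606.01861, Thm. 1.2 (p. 3). [MunteanuWang2016]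
-/

noncomputable section

open Bundle Set Function Module MeasureTheory
open scoped Manifold ContDiff Topology

namespace Literature.Geometry.Riemannian

open Lorentzian Lorentzian.PseudoRiemannianMetric

namespace ThreeShrinker

/-- **The conclusion of `threeShrinkerClassification_modelData` for compact members with
`Ric ≥ (R/3) h`** (the "all eigenvalues equal" case of Eminenti–La Nave–Mantegazza's minimum-point
analysis). [cite: EminentiLanaveMantegazza2008, §3 (p. 7)] [cite: MunteanuWang2016, Thm 1.2 (p. 3)] -/
theorem modelData_of_ricci_ge_third (N : Type*) [TopologicalSpace N] [T2Space N]
    [ChartedSpace (EuclideanSpace ℝ (Fin 3)) N] [IsManifold (𝓡 3) ∞ N] [CompactSpace N]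
    [ConnectedSpace N] [MeasurableSpace N] [BorelSpace N] [T3Space N]
    (g : PseudoRiemannianMetric (𝓡 3) ∞ (EuclideanSpace ℝ (Fin 3))
      (TangentSpace (𝓡 3) : N → Type _)) [g.HasLeviCivita] (hg : g.IsRiemannian)
    (φ : N → ℝ) (hφ : ContMDiff (𝓡 3) 𝓘(ℝ, ℝ) ∞ φ)
    (hsol : ∀ (x : N) (X Y : TangentSpace (𝓡 3) x),
      g.ricci x X Y + g.hessian φ x X Y = (1 / 2 : ℝ) * g.val x X Y)
    (hnorm : ∀ x : N, g.scalarCurvature x + g.gradSq φ x = φ x)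
    (hRic : ∀ (x : N) (w : TangentSpace (𝓡 3) x),
      g.scalarCurvature x / 3 * g.val x w w ≤ g.ricci x w w) :
    ((∀ x : N, g.scalarCurvature x = 0) ∧
        ∫⁻ x, ENNReal.ofReal (Real.exp (-φ x))
            ∂(riemannianMeasure (g.toContMDiffRiemannianMetric hg)) =
          ENNReal.ofReal (8 * Real.pi * Real.sqrt Real.pi)) ∨
    (CompactSpace N ∧ (∀ x : N, g.scalarCurvature x = 3 / 2) ∧ (∀ x : N, φ x = 3 / 2) ∧
        ∃ k : ℕ, 0 < k ∧
          riemannianMeasure (g.toContMDiffRiemannianMetric hg) Set.univ =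
            ENNReal.ofReal (16 * Real.pi ^ 2 / k)) ∨
    ((∀ x : N, g.scalarCurvature x = 1) ∧
        ∫⁻ x, ENNReal.ofReal (Real.exp (-φ x))
            ∂(riemannianMeasure (g.toContMDiffRiemannianMetric hg)) =
          ENNReal.ofReal (16 * Real.pi * Real.sqrt Real.pi * Real.exp (-1))) ∨
    ((∀ x : N, g.scalarCurvature x = 1) ∧
        ∫⁻ x, ENNReal.ofReal (Real.exp (-φ x))
            ∂(riemannianMeasure (g.toContMDiffRiemannianMetric hg)) =
          ENNReal.ofReal (8 * Real.pi * Real.sqrt Real.pi * Real.exp (-1))) := by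
  have h2 : (2 : ℕ∞ω) ≤ ((⊤ : ℕ∞) : ℕ∞ω) := WithTop.coe_le_coe.mpr le_top
  have h3 : finrank ℝ (EuclideanSpace ℝ (Fin 3)) = 3 := finrank_euclideanSpace_fin
  have hpt : ∀ (x : N) (X Y : TangentSpace (𝓡 3) x),
      g.ricci x X Y = g.scalarCurvature x / 3 * g.val x X Y := by
    intro x X Y
    have h := ricci_eq_smul_of_forall_le g h2 (hg x) (x := x) (fun w ↦ by
      rw [h3]; exact_mod_cast hRic x w) X Y
    rw [h3] at h
    exact_mod_cast h
  exact modelData_of_ricci_eq_fun_smul N g hg φ hφ hsol hnorm hpt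

end ThreeShrinker

end Literature.Geometry.Riemannian

end
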